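import Summits.AnomalousDissipation.AnomalousDissipation.Theorems.MarginalStabilityChainStrainedLayerLawClockEnstrophyClockExact
import Summits.AnomalousDissipation.AnomalousDissipation.Theorems.MarginalStabilityChainStrainedLayerLawClockEnstrophyWindowCeiling
import Summits.AnomalousDissipation.AnomalousDissipation.Theorems.MarginalStabilityChainStrainedLayerLawStubStrainWorkIdentity
import HarnessLib

/-!
# Crux `MarginalStabilityChain.StrainedLayerLaw` (stmt-AnomalousDissipation-3007), line `FirstLemmasR2K4`:
# the three faces of the windowed dissipation

Support file (`--supports stmt-AnomalousDissipation-3007`; registered sub-goal `meanDissipation_faces` of line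
`FirstLemmasR2K4`, lead c7, cycle 1). For ONE classical solution `(u, v, p)` of the stretched layer class on `(0, ∞)`
(`ν > 0`, period `L > 0`) with shear tails on every compact time window and every `T > 1`, the dissipation of the window
`(1, T]` has three exact expressions:

* ENSTROPHY face: `L · ∫_{(1,T]} D = ν ∫_1^T Ω` (`Ω(τ) = ∫∫ ω(τ)²` over one period strip; `D = (ν/L)∫∫|∇(u,v)|²` and
  `∫∫|∇(u,v)|² = ∫∫ω²` under tails — `layerDissipation_eq_ofReal`, `kato_integral_gradSq_eq_enstrophy`);
* PALINSTROPHY face: `ν ∫_1^T Ω = 2ν² ∫_1^T P + ν (Ω(T) − Ω(1))` (`P(τ) = ∫∫ |∇ω(τ)|²`; the total-enstrophy identity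
  `Ω(T) − Ω(1) = ∫_1^T (Ω − 2νP)` of `enstrophy_clock_exact`, rearranged). Since `Ω` is bounded for `t ≥ 1` at fixed `ν`
  (`stub_vorticityUniformBounds`), the long-time MEAN dissipation is `2ν²⟨P⟩/L`: the crux's plasmoid law is a PALINSTROPHY
  FLOOR `ν²⟨P⟩ ≳ L·min(L,1)` (laminar layer: `ν²P = L√ν/(4√π) → 0`; one round Burgers core of circulation `L`: `ν²P = O(L²)`);
* STRAIN-WORK face: `L · ∫_{(1,T]} D = ∫_1^T J − (E(T) − E(1))` (`J = ½∫∫(¼ − u² + v²)`, `E = ½∫∫(u² + v² − ¼)`; the landed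
  `stub_strainWorkIdentity` verbatim on `[1, T]`).

No facts are asserted; the file only assembles landed theorems.
-/

-- `Summit.<Summit>.<Problem>` is the tree's mandated summit-side namespace (CONVENTIONS §2); for this
-- single-conjunct summit the two coincide, so the duplicate is deliberate.
set_option linter.dupNamespace false

noncomputable section

open scoped Topology ENNReal
open Filter Set Function MeasureTheory

namespace Summit.AnomalousDissipation.AnomalousDissipation.Theorems.StrainedLayerLaw.LogEnstrophyClock

open Literature.Analysis.FluidPDE Literature.Analysis.FluidPDE.StretchedLayer
open Summit.AnomalousDissipation.AnomalousDissipation.Theses.MarginalStabilityChain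
open Summit.AnomalousDissipation.AnomalousDissipation.Theorems.StrainedLayerLaw.StrainWorkSumRule

section Faces

variable {ν L : ℝ} {u v p : ℝ → ℝ → ℝ → ℝ}

/-- Slice facts under tails at one instant `τ > 0`: Fubini for `ω²` (iterated = strip form) and the dissipation of the
slice as the real number `(ν/L)∫∫ω²` (`layerDissipation_eq_ofReal` + `kato_integral_gradSq_eq_enstrophy`; the proof is the
`hfacts` block of `enstrophy_window_ceiling`). [folklore] -/
theorem faces_slice (hν : 0 < ν) (hL : 0 < L) (hsol : IsStretchedLayerNSSolutionOn (Ioi 0) ν 1 1 L u v p)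
    (htails : ∀ a b : ℝ, 0 < a → a < b → ExpTails (Icc a b) u v) {τ : ℝ} (hτ : 0 < τ) :
    (∫ x in Ioc 0 L, ∫ y, vorticity (u τ) (v τ) x y ^ 2) =
        ∫ q in Ioc 0 L ×ˢ univ, vorticity (u τ) (v τ) q.1 q.2 ^ 2 ∧
      layerDissipation ν L (u τ) (v τ) =
        ENNReal.ofReal (ν / L * ∫ x in Ioc 0 L, ∫ y, vorticity (u τ) (v τ) x y ^ 2) := by
  have hνL : 0 ≤ ν / L := div_nonneg hν.le hL.le
  obtain ⟨C, k, hk, hCk⟩ := htails (τ / 2) (τ + 1) (by positivity) (by linarith)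
  have hτI : τ ∈ Icc (τ / 2) (τ + 1) := ⟨by linarith, by linarith⟩
  have hT : SliceTails C k (u τ) (v τ) := (hCk τ hτI).1
  have hτ' : τ ∈ Ioi (0:ℝ) := hτ
  have hu2 := hsol.contDiff_u hτ'
  have hv2 := hsol.contDiff_v hτ'
  have hiter : (∫ x in Ioc 0 L, ∫ y, vorticity (u τ) (v τ) x y ^ 2) =
      ∫ q in Ioc 0 L ×ˢ univ, vorticity (u τ) (v τ) q.1 q.2 ^ 2 :=
    integral_iterated_eq_strip (enstrophyCeiling_integrableOn_sq hk hT hu2 hv2)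
  refine ⟨hiter, ?_⟩
  have hTd : ∀ x y, |deriv (fun r => u r x y) τ| + |deriv (fun r => v r x y) τ| ≤ C * Real.exp (-k * |y|) := by
    intro x y
    have h1 := (hCk τ hτI).2 x y
    rwa [dT_of_isOpen isOpen_Ioi u hτ', dT_of_isOpen isOpen_Ioi v hτ'] at h1
  have hsl := stub_strainWorkIdentity_slice ν L τ C k u v p hL hτ hk hsol hT hTd
  have h1 : ContDiff ℝ 1 (fun q : ℝ × ℝ => u τ q.1 q.2) := hu2.of_le one_le_two
  have h2 : ContDiff ℝ 1 (fun q : ℝ × ℝ => v τ q.1 q.2) := hv2.of_le one_le_two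
  rw [hiter, layerDissipation_eq_ofReal hνL (((((continuous_dX h1).pow 2).add ((continuous_dY h1).pow 2)).add
    ((continuous_dX h2).pow 2)).add ((continuous_dY h2).pow 2)) hsl.2.2.1,
    kato_integral_gradSq_eq_enstrophy hL hk hT hu2 hv2 (hsol.divFree τ hτ') (hsol.periodic_u τ hτ')
      (hsol.periodic_v τ hτ')]

/-- The total enstrophy `τ ↦ Ω(τ)` (iterated form) is continuous on `(0, ∞)` along a tailed solution (it is even
differentiable: `enstrophyClock_hasDerivAt`). [folklore] -/
theorem faces_enstrophy_continuousOn (hν : 0 < ν) (hL : 0 < L)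
    (hsol : IsStretchedLayerNSSolutionOn (Ioi 0) ν 1 1 L u v p)
    (htails : ∀ a b : ℝ, 0 < a → a < b → ExpTails (Icc a b) u v) :
    ContinuousOn (fun τ => ∫ x in Ioc 0 L, ∫ y, vorticity (u τ) (v τ) x y ^ 2) (Ioi 0) :=
  fun _ hτ => (enstrophyClock_hasDerivAt hν hL hsol htails hτ).continuousAt.continuousWithinAt

/-- **ENSTROPHY face.** For `T > 1`: `L · (∫⁻_{(1,T]} D).toReal = ν ∫_1^T Ω` (and the window lintegral is finite).
[folklore] -/
theorem faces_enstrophy (hν : 0 < ν) (hL : 0 < L) (hsol : IsStretchedLayerNSSolutionOn (Ioi 0) ν 1 1 L u v p)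
    (htails : ∀ a b : ℝ, 0 < a → a < b → ExpTails (Icc a b) u v) {T : ℝ} (hT : 1 < T) :
    L * (∫⁻ t in Ioc 1 T, layerDissipation ν L (u t) (v t)).toReal =
      ν * ∫ τ in (1:ℝ)..T, (∫ x in Ioc 0 L, ∫ y, vorticity (u τ) (v τ) x y ^ 2) := by
  set Ω : ℝ → ℝ := fun τ => ∫ x in Ioc 0 L, ∫ y, vorticity (u τ) (v τ) x y ^ 2 with hΩ
  have hνL : 0 ≤ ν / L := div_nonneg hν.le hL.le
  -- `D = ofReal ((ν/L) Ω)` on the window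
  have hD : ∀ τ ∈ Ioc (1:ℝ) T, layerDissipation ν L (u τ) (v τ) = ENNReal.ofReal (ν / L * Ω τ) := fun τ hτ =>
    (faces_slice hν hL hsol htails (one_pos.trans hτ.1)).2
  have hcongr : ∫⁻ t in Ioc 1 T, layerDissipation ν L (u t) (v t) = ∫⁻ t in Ioc 1 T, ENNReal.ofReal (ν / L * Ω t) :=
    setLIntegral_congr_fun measurableSet_Ioc hD
  -- continuity and integrability of `(ν/L) Ω` on `[1, T]`
  have hΩc : ContinuousOn Ω (Icc 1 T) :=
    (faces_enstrophy_continuousOn hν hL hsol htails).mono fun τ hτ => one_pos.trans_le hτ.1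
  have hgc : ContinuousOn (fun τ => ν / L * Ω τ) (Icc 1 T) := continuousOn_const.mul hΩc
  have hgi : IntegrableOn (fun τ => ν / L * Ω τ) (Ioc 1 T) :=
    (hgc.integrableOn_compact isCompact_Icc).mono_set Ioc_subset_Icc_self
  have hg0 : 0 ≤ᵐ[volume.restrict (Ioc 1 T)] fun τ => ν / L * Ω τ := by
    refine (ae_restrict_iff' measurableSet_Ioc).2 (Eventually.of_forall fun τ _ => ?_)
    exact mul_nonneg hνL (integral_nonneg fun x => integral_nonneg fun y => sq_nonneg _)
  have hlin : ∫⁻ t in Ioc 1 T, ENNReal.ofReal (ν / L * Ω t) = ENNReal.ofReal (∫ t in Ioc 1 T, ν / L * Ω t) :=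
    (ofReal_integral_eq_lintegral_ofReal hgi hg0).symm
  have hI0 : 0 ≤ ∫ t in Ioc 1 T, ν / L * Ω t := setIntegral_nonneg measurableSet_Ioc fun τ _ =>
    mul_nonneg hνL (integral_nonneg fun x => integral_nonneg fun y => sq_nonneg _)
  rw [hcongr, hlin, ENNReal.toReal_ofReal hI0, ← intervalIntegral.integral_of_le hT.le,
    intervalIntegral.integral_const_mul]
  field_simp

/-- **PALINSTROPHY face.** For `0 < s ≤ T`: `ν ∫_s^T Ω = 2ν² ∫_s^T P + ν (Ω(T) − Ω(s))` — the total-enstrophy identity of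
`enstrophy_clock_exact` rearranged (interval integrability from the continuity of `Ω` and of `Ω − 2νP`). [folklore] -/
theorem faces_palinstrophy (hν : 0 < ν) (hL : 0 < L) (hsol : IsStretchedLayerNSSolutionOn (Ioi 0) ν 1 1 L u v p)
    (htails : ∀ a b : ℝ, 0 < a → a < b → ExpTails (Icc a b) u v) {s T : ℝ} (hs : 0 < s) (hsT : s ≤ T) :
    ν * (∫ τ in s..T, (∫ x in Ioc 0 L, ∫ y, vorticity (u τ) (v τ) x y ^ 2)) =
      2 * ν ^ 2 * (∫ τ in s..T, ∫ x in Ioc 0 L, ∫ y,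
          (dX (vorticity (u τ) (v τ)) x y ^ 2 + dY (vorticity (u τ) (v τ)) x y ^ 2)) +
        ν * ((∫ x in Ioc 0 L, ∫ y, vorticity (u T) (v T) x y ^ 2) -
          (∫ x in Ioc 0 L, ∫ y, vorticity (u s) (v s) x y ^ 2)) := by
  set Ω : ℝ → ℝ := fun τ => ∫ x in Ioc 0 L, ∫ y, vorticity (u τ) (v τ) x y ^ 2 with hΩ
  set P : ℝ → ℝ := fun τ => ∫ x in Ioc 0 L, ∫ y,
    (dX (vorticity (u τ) (v τ)) x y ^ 2 + dY (vorticity (u τ) (v τ)) x y ^ 2) with hP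
  have hid : Ω T - Ω s = ∫ τ in s..T, (Ω τ - 2 * ν * P τ) :=
    (enstrophy_clock_exact ν L hν hL u v p hsol htails).1 s T hs hsT
  have hsub : uIcc s T ⊆ Ioi 0 := fun τ hτ => by rw [uIcc_of_le hsT] at hτ; exact hs.trans_le hτ.1
  have hΩi : IntervalIntegrable Ω volume s T :=
    ((faces_enstrophy_continuousOn hν hL hsol htails).mono hsub).intervalIntegrable
  have hgi : IntervalIntegrable (fun τ => Ω τ - 2 * ν * P τ) volume s T :=
    ((enstrophyClock_continuousOn hsol htails).mono hsub).intervalIntegrable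
  have hPi : IntervalIntegrable (fun τ => 2 * ν * P τ) volume s T := by
    have := hΩi.sub hgi
    refine this.congr ?_
    exact fun τ _ => by ring
  have hsplit : ∫ τ in s..T, (Ω τ - 2 * ν * P τ) = (∫ τ in s..T, Ω τ) - ∫ τ in s..T, 2 * ν * P τ :=
    intervalIntegral.integral_sub hΩi hPi
  have hcm : ∫ τ in s..T, 2 * ν * P τ = 2 * ν * ∫ τ in s..T, P τ := intervalIntegral.integral_const_mul _ _
  rw [hsplit, hcm] at hid
  have : ν * (∫ τ in s..T, Ω τ) = ν * (2 * ν * ∫ τ in s..T, P τ) + ν * (Ω T - Ω s) := by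
    rw [← mul_add]; congr 1; linarith
  rw [this]; ring

end Faces

/-- **The three faces of the windowed dissipation (registered sub-goal `meanDissipation_faces` of line
`FirstLemmasR2K4`).** For one classical solution of the stretched layer class on `(0, ∞)` with shear tails on every
compact time window and every `T > 1`:
(enstrophy) `L·∫⁻_{(1,T]} D = ν∫_1^T Ω`; (palinstrophy) `ν∫_1^T Ω = 2ν²∫_1^T P + ν(Ω(T) − Ω(1))`;
(strain work) `L·∫⁻_{(1,T]} D = ∫_1^T J − (E(T) − E(1))`. With the fixed-ν bound `Ω ≤ B` (`stub_vorticityUniformBounds`) and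
the sublinearity of `E` (`excessEnergySublinear_of_vorticityBounds`) all three Cesàro means coincide:
`⟨D⟩ = ν⟨Ω⟩/L = 2ν²⟨P⟩/L = ⟨J⟩/L` — the plasmoid law is equivalently an enstrophy floor `ν⟨Ω⟩ ≳ L·min(L,1)`, a
palinstrophy floor `ν²⟨P⟩ ≳ L·min(L,1)/2`, or a strain-work floor `⟨J⟩ ≳ L·min(L,1)`. [folklore] -/
theorem meanDissipation_faces : ∀ (ν L : ℝ), 0 < ν → 0 < L → ∀ (u v p : ℝ → ℝ → ℝ → ℝ),
    IsStretchedLayerNSSolutionOn (Ioi 0) ν 1 1 L u v p → (∀ a b : ℝ, 0 < a → a < b → ExpTails (Icc a b) u v) →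
    ∀ T : ℝ, 1 < T →
      L * (∫⁻ t in Ioc 1 T, layerDissipation ν L (u t) (v t)).toReal =
          ν * ∫ τ in (1:ℝ)..T, (∫ x in Ioc 0 L, ∫ y, vorticity (u τ) (v τ) x y ^ 2) ∧
      ν * (∫ τ in (1:ℝ)..T, (∫ x in Ioc 0 L, ∫ y, vorticity (u τ) (v τ) x y ^ 2)) =
          2 * ν ^ 2 * (∫ τ in (1:ℝ)..T, ∫ x in Ioc 0 L, ∫ y,
              (dX (vorticity (u τ) (v τ)) x y ^ 2 + dY (vorticity (u τ) (v τ)) x y ^ 2)) +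
            ν * ((∫ x in Ioc 0 L, ∫ y, vorticity (u T) (v T) x y ^ 2) -
              (∫ x in Ioc 0 L, ∫ y, vorticity (u 1) (v 1) x y ^ 2)) ∧
      L * (∫⁻ t in Ioc 1 T, layerDissipation ν L (u t) (v t)).toReal =
          (∫ t in (1:ℝ)..T, strainWork L (u t) (v t)) - (excessEnergy L (u T) (v T) - excessEnergy L (u 1) (v 1)) := by
  intro ν L hν hL u v p hsol htails T hT
  refine ⟨faces_enstrophy hν hL hsol htails hT, faces_palinstrophy hν hL hsol htails one_pos hT.le, ?_⟩
  exact (stub_strainWorkIdentity ν L 1 T hν hL one_pos hT u v p hsol (htails 1 T one_pos hT)).2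

end Summit.AnomalousDissipation.AnomalousDissipation.Theorems.StrainedLayerLaw.LogEnstrophyClock

end
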